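import Mathlib
import Literature.Computability.Complexity.CircuitAdderMultiplier
import Literature.ModelTheory.FiniteModelTheory.ESODefinability
import Literature.ModelTheory.FiniteModelTheory.CodeLayout

/-!
# Route PositionalGames — support item `MpgHardNpLanguage` (stmt-PneNP-1300): definitions

All DEFINITIONS of the proof of `Summit.PneNP.PneNP.Theses.PositionalGames.MpgHardNpLanguage`
(the proofs are in the sibling theorem-only files `…Arith`, `…Potential`, `…Query`, `…Semantics`,
`…Complete` and `PositionalGamesMpgHardNpLanguage.lean`). They are proof-internal objects —
nothing here is posited by the route or restates a published theorem:

* ripple-carry transcripts on bit rows `Fin m → Bool` (`carrySeq`, `carryRow`, `sumRow`, the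
  first-order-friendly predicate `AddOK`, `natRow`; Vollmer 1999 §1.1, the school method);
* simple paths as injective sequences, their weights, and the CYCLE CONDITION of an arena with a
  total successor relation (`IsPath`, `pathWt`, `CycleCondition`, `pathWts`);
* the relational vocabularies of the `∃SO` certificate (`inVocab`: `IsV, Ow, St, Ed, W2, PN, LT`;
  `witVocab`: `Sg, Rr, Ph, S1, C1, S2, C2, Dd, C3`), their atoms as `Prop`s, and the certificate
  check itself as a closed query `mpgQuery` in the style of the tree's `ESODefinability.lean`
  (`EP`, `AddQ`, `Q1`, `Q2`, `Q3`, `mpgQ`; `RowDef` = uniform definability of a bit-row family);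
* the finite structure `gameTab n o v x` on `Fin (2n+2)` presenting a threshold mean-payoff
  template `(o, v)` of the route with input `x` (vertices = the first `n` elements, `vx`; the
  universe = bit positions), the rows `pnRow` (`2ⁿ`) and `w2Row` (`2·w(u)`), the route's inline
  weight `wt` and winning predicate `MpgWin` (VERBATIM the argument of `decide` in the route
  decls `MpgGeneralSuperpoly`, …, `MpgHardNpLanguage`);
* the witness tables `witTab` of the completeness proof (strategy, reachable set, potential rows
  and the school additions `Ph + PN`, `Ph + W2`, `S1 b + Dd a b`) and the Odd arena `oddArena`;
* the code length `codeLenG` and the code bits `codeBitG` of a game structure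
  (`CodeLayout.codeOf`).

References: U. Zwick, M. Paterson, *The complexity of mean payoff games on graphs*, TCS 158
(1996), §1–2; H. Vollmer, *Introduction to Circuit Complexity* (1999), §1.1; R. Fagin (1974), §2;
L. Libkin, *Elements of Finite Model Theory* (2004), (6.1).
-/

namespace Summit.PneNP.PneNP.Theorems.MpgNP

set_option linter.dupNamespace false -- `Summit.PneNP.PneNP.…`: summit = sub-problem (D-0017)

open Literature.ModelTheory.FiniteModelTheory Literature.Computability.Cryptography
open Literature.Computability.Complexity.ArithCkt Finset Filter

/-! ### Bit rows and ripple-carry transcripts -/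

/-- The carries of the school addition of two rows, as a sequence on `ℕ` (`false` from position
`m + 1` on, irrelevant). [cite: Vollmer1999, §1.1] -/
def carrySeq {m : ℕ} (A B : Fin m → Bool) : ℕ → Bool
  | 0 => false
  | k + 1 => if h : k < m then faCarry (A ⟨k, h⟩) (B ⟨k, h⟩) (carrySeq A B k) else false

/-- The carry row of the school addition (`carryRow A B j` = carry INTO position `j`).
[cite: Vollmer1999, §1.1] -/
def carryRow {m : ℕ} (A B : Fin m → Bool) : Fin m → Bool := fun j => carrySeq A B j

/-- The sum row of the school addition. [cite: Vollmer1999, §1.1] -/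
def sumRow {m : ℕ} (A B : Fin m → Bool) : Fin m → Bool := fun j => faSum (A j) (B j) (carryRow A B j)

/-- **Ripple-carry transcript, first-order form.** Rows `A, B` (summands), `S` (sum) and `C`
(carries, `C j` = carry INTO position `j`) on positions `Fin m`: carry-in `0` at the least
position, the full-adder equations at every position / pair of consecutive positions, and no carry
out of the top position (no overflow). [cite: Vollmer1999, §1.1] -/
def AddOK {m : ℕ} (A B S C : Fin m → Bool) : Prop :=
  (∀ j : Fin m, (j : ℕ) = 0 → C j = false) ∧
  (∀ j : Fin m, S j = faSum (A j) (B j) (C j)) ∧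
  (∀ j j' : Fin m, (j' : ℕ) = (j : ℕ) + 1 → C j' = faCarry (A j) (B j) (C j)) ∧
  (∀ j : Fin m, (j : ℕ) + 1 = m → faCarry (A j) (B j) (C j) = false)

/-- The `m`-bit row of a natural number (little-endian binary digits). [folklore] -/
def natRow (m a : ℕ) : Fin m → Bool := fun j => a.testBit j

/-! ### Simple paths and the cycle condition -/

section Paths

variable {n : ℕ}

/-- A simple `E`-path from `v` to `u` with `k` edges, as a sequence `a : ℕ → Fin n` read on
`[0, k]`: starts at `v`, ends at `u`, consecutive vertices are `E`-related, no vertex repeats.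
[folklore] -/
def IsPath (E : Fin n → Fin n → Prop) (v u : Fin n) (a : ℕ → Fin n) (k : ℕ) : Prop :=
  a 0 = v ∧ a k = u ∧ (∀ t, t < k → E (a t) (a (t + 1))) ∧
    ∀ s t, s ≤ k → t ≤ k → a s = a t → s = t

/-- The weight of a path: the weights of all its vertices but the last. [folklore] -/
def pathWt (c : Fin n → ℤ) (a : ℕ → Fin n) (k : ℕ) : ℤ := ∑ t ∈ range k, c (a t)

/-- **The cycle condition** on `(E, c, v)`: for every choice function `f` of `E` and every
repetition window `f^[i] v = f^[j] v`, `i < j`, before which the orbit is injective, the window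
has non-negative total weight `Σ_{t ∈ [i,j)} c (f^[t] v) ≥ 0` ("every lasso cycle Odd can steer
into has non-negative weight"). [folklore] -/
def CycleCondition (E : Fin n → Fin n → Prop) (c : Fin n → ℤ) (v : Fin n) : Prop :=
  ∀ f : Fin n → Fin n, (∀ u, E u (f u)) → ∀ i j : ℕ, i < j → f^[i] v = f^[j] v →
    (∀ s t, s < j → t < j → f^[s] v = f^[t] v → s = t) → 0 ≤ ∑ t ∈ Ico i j, c (f^[t] v)

/-- The set of weights of simple paths from `v` to `u`. [folklore] -/
def pathWts (E : Fin n → Fin n → Prop) (c : Fin n → ℤ) (v u : Fin n) : Set ℤ :=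
  {x | ∃ (a : ℕ → Fin n) (k : ℕ), IsPath E v u a k ∧ pathWt c a k = x}

end Paths

/-! ### Vocabularies and atoms of the certificate -/

/-- Input vocabulary: `IsV, Ow, St` unary, `Ed, W2` binary, `PN` unary, `LT` binary. [folklore] -/
abbrev inVocab : List ℕ := [1, 1, 1, 2, 2, 1, 2]

/-- Witness vocabulary: `Sg` (2), `Rr` (1), `Ph, S1, C1, S2, C2` (2), `Dd, C3` (3). [folklore] -/
abbrev witVocab : List ℕ := [2, 1, 2, 2, 2, 2, 2, 3, 3]

/-- Symbol `IsV`. [folklore] -/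
def iIsV : Fin inVocab.length := ⟨0, by decide⟩
/-- Symbol `Ow`. [folklore] -/
def iOw : Fin inVocab.length := ⟨1, by decide⟩
/-- Symbol `St`. [folklore] -/
def iSt : Fin inVocab.length := ⟨2, by decide⟩
/-- Symbol `Ed`. [folklore] -/
def iEd : Fin inVocab.length := ⟨3, by decide⟩
/-- Symbol `W2`. [folklore] -/
def iW2 : Fin inVocab.length := ⟨4, by decide⟩
/-- Symbol `PN`. [folklore] -/
def iPN : Fin inVocab.length := ⟨5, by decide⟩
/-- Symbol `LT`. [folklore] -/
def iLT : Fin inVocab.length := ⟨6, by decide⟩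
/-- Symbol `Sg`. [folklore] -/
def jSg : Fin witVocab.length := ⟨0, by decide⟩
/-- Symbol `Rr`. [folklore] -/
def jRr : Fin witVocab.length := ⟨1, by decide⟩
/-- Symbol `Ph`. [folklore] -/
def jPh : Fin witVocab.length := ⟨2, by decide⟩
/-- Symbol `S1`. [folklore] -/
def jS1 : Fin witVocab.length := ⟨3, by decide⟩
/-- Symbol `C1`. [folklore] -/
def jC1 : Fin witVocab.length := ⟨4, by decide⟩
/-- Symbol `S2`. [folklore] -/
def jS2 : Fin witVocab.length := ⟨5, by decide⟩
/-- Symbol `C2`. [folklore] -/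
def jC2 : Fin witVocab.length := ⟨6, by decide⟩
/-- Symbol `Dd`. [folklore] -/
def jDd : Fin witVocab.length := ⟨7, by decide⟩
/-- Symbol `C3`. [folklore] -/
def jC3 : Fin witVocab.length := ⟨8, by decide⟩

section Atoms

variable {m : ℕ} (R : RelTables inVocab m) (W : RelTables witVocab m)

/-- `a` is a vertex. [folklore] -/
def isV (a : Fin m) : Prop := R iIsV ![a] = true
/-- `a` belongs to Even. [folklore] -/
def ow (a : Fin m) : Prop := R iOw ![a] = true
/-- `a` is the start vertex. [folklore] -/
def st (a : Fin m) : Prop := R iSt ![a] = true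
/-- Edge bit `(a, b)`. [folklore] -/
def ed (a b : Fin m) : Prop := R iEd ![a, b] = true
/-- Bit `j` of twice the weight of `a`. [folklore] -/
def w2 (a j : Fin m) : Prop := R iW2 ![a, j] = true
/-- Bit `j` of `2ⁿ`. [folklore] -/
def pn (j : Fin m) : Prop := R iPN ![j] = true
/-- Position `i` is below position `j`. [folklore] -/
def lt (i j : Fin m) : Prop := R iLT ![i, j] = true
/-- Even's guessed move `a ↦ b`. [folklore] -/
def sg (a b : Fin m) : Prop := W jSg ![a, b] = true
/-- `a` is in the guessed successor-closed set. [folklore] -/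
def rr (a : Fin m) : Prop := W jRr ![a] = true
/-- Bit `j` of the shifted potential of `a`. [folklore] -/
def ph (a j : Fin m) : Prop := W jPh ![a, j] = true
/-- Bit `j` of `Ph a + 2ⁿ`. [folklore] -/
def s1 (a j : Fin m) : Prop := W jS1 ![a, j] = true
/-- Carry into position `j` of `Ph a + 2ⁿ`. [folklore] -/
def c1 (a j : Fin m) : Prop := W jC1 ![a, j] = true
/-- Bit `j` of `Ph a + 2·w(a)`. [folklore] -/
def s2 (a j : Fin m) : Prop := W jS2 ![a, j] = true
/-- Carry into position `j` of `Ph a + 2·w(a)`. [folklore] -/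
def c2 (a j : Fin m) : Prop := W jC2 ![a, j] = true
/-- Bit `j` of the guessed difference `S2 a - S1 b`. [folklore] -/
def dd (a b j : Fin m) : Prop := W jDd ![a, b, j] = true
/-- Carry into position `j` of `S1 b + Dd a b`. [folklore] -/
def c3 (a b j : Fin m) : Prop := W jC3 ![a, b, j] = true

end Atoms

/-! ### The certificate check as a closed query -/

section QueryDefs

variable {m : ℕ} (R : RelTables inVocab m) (W : RelTables witVocab m)

/-- The successor relation of the arena once Even follows the guessed strategy `Sg`: from an
Even vertex the guessed PRESENT edges, from an Odd vertex every edge whose bit is `0` (the route's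
complemented encoding of Odd edges), between vertices only. [folklore] -/
def EP (a b : Fin m) : Prop :=
  isV R a ∧ isV R b ∧ ((ow R a ∧ sg W a b ∧ ed R a b) ∨ (¬ ow R a ∧ ¬ ed R a b))

/-- Least position (no predecessor in `LT`). [folklore] -/
def IsMinP (j : Fin m) : Prop := ∀ i, ¬ lt R i j

/-- `j'` is the successor position of `j` in `LT`. [folklore] -/
def CoversP (j j' : Fin m) : Prop := lt R j j' ∧ ∀ k, ¬ (lt R j k ∧ lt R k j')

/-- Greatest position. [folklore] -/
def IsMaxP (j : Fin m) : Prop := ∀ k, ¬ lt R j k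

/-- The carry of a full adder as a propositional formula: `MAJ(p,q,r) = (p ∧ q) ∨ (r ∧ (p ⊕ q))`.
[cite: Vollmer1999, §1.1] -/
def MajP (p q r : Prop) : Prop := (p ∧ q) ∨ (r ∧ ¬ (p ↔ q))

/-- **Ripple-carry transcript, first-order form**: rows `A, B` (summands), `S` (sum), `C`
(carries) as predicates on positions; carry-in `0` at the least position, sum bits
`S ↔ (A ⊕ B ⊕ C)`, carry propagation along successor positions, no carry out of the greatest
position. [cite: Vollmer1999, §1.1] -/
def AddQ (A B S C : Fin m → Prop) : Prop :=
  (∀ j, IsMinP R j → ¬ C j) ∧ (∀ j, S j ↔ ((A j ↔ B j) ↔ C j)) ∧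
    (∀ j j', CoversP R j j' → (C j' ↔ MajP (A j) (B j) (C j))) ∧
      (∀ j, IsMaxP R j → ¬ MajP (A j) (B j) (C j))

end QueryDefs

section QueryTop

variable {m : ℕ}

/-- `Q1`: every Even vertex has a successor (the guessed strategy offers a present edge).
[folklore] -/
def Q1 (R : RelTables inVocab m) (W : RelTables witVocab m) : Prop :=
  ∀ a, isV R a → ow R a → ∃ b, EP R W a b

/-- `Q2`: some Odd vertex has no successor (no legal Odd strategy exists). [folklore] -/
def Q2 (R : RelTables inVocab m) (W : RelTables witVocab m) : Prop :=
  ∃ a, isV R a ∧ ¬ ow R a ∧ ∀ b, ¬ EP R W a b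

/-- `Q3`: the potential certificate — the guessed set contains the start, the rows `S1 = Ph + PN`
and `S2 = Ph + W2` are certified sums, and along every edge `a → b` leaving the set, `b` is in the
set and `S1 b + Dd a b = S2 a` is a certified sum (so `Ph b + 2ⁿ ≤ Ph a + 2·w(a)`). [folklore] -/
def Q3 (R : RelTables inVocab m) (W : RelTables witVocab m) : Prop :=
  (∀ a, st R a → rr W a) ∧ (∀ a, AddQ R (ph W a) (pn R) (s1 W a) (c1 W a)) ∧
    (∀ a, AddQ R (ph W a) (w2 R a) (s2 W a) (c2 W a)) ∧
      (∀ a b, rr W a → EP R W a b → rr W b ∧ AddQ R (s1 W b) (dd W a b) (s2 W a) (c3 W a b))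

/-- The whole first-order check on input tables `R` and witness tables `W`: `Q1 ∧ (Q2 ∨ Q3)`.
[folklore] -/
def mpgQ (R : RelTables inVocab m) (W : RelTables witVocab m) : Prop := Q1 R W ∧ (Q2 R W ∨ Q3 R W)

end QueryTop

/-- The check as a closed query on joint structures (`ESODefinability.JQuery`). [folklore] -/
def mpgQuery : JQuery inVocab witVocab Empty := fun _ R W _ => mpgQ R W

section RowFamilies

variable {β : Type}

/-- A ROW FAMILY `A R W v j` (a predicate on positions `j` depending on the valuation `v` of the
variables `β`) is UNIFORMLY DEFINABLE if it is definable with the position read from any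
variable after any renaming. [folklore] -/
def RowDef (A : ∀ ⦃n : ℕ⦄, RelTables inVocab n → RelTables witVocab n → (β → Fin n) → Fin n → Prop) :
    Prop :=
  ∀ (γ : Type) (g : β → γ) (y : γ),
    JQuery.IsDef (fun n (R : RelTables inVocab n) (W : RelTables witVocab n) (v : γ → Fin n) =>
      A R W (v ∘ g) (v y))

end RowFamilies

/-! ### Games as finite structures -/

section Games

variable {n : ℕ}

/-- The universe size of the structure of an `n`-vertex game: `2n + 2` bit positions. [folklore] -/
abbrev usize (n : ℕ) : ℕ := 2 * n + 2

/-- Vertex `u` as an element of the universe. [folklore] -/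
def vx (u : Fin n) : Fin (usize n) := ⟨u, by unfold usize; omega⟩

/-- The route's inline vertex weight `w(u) = Σⱼ [x(u,j)]·2ʲ`. [folklore] -/
def wt (x : (Fin n × Fin n) ⊕ (Fin n × Fin n) → Bool) (u : Fin n) : ℕ :=
  ∑ j : Fin n, if x (Sum.inr (u, j)) = true then 2 ^ (j : ℕ) else 0

/-- **The tables of a game.** `IsV a :↔ a < n`; `Ow a :↔ o a`; `St a :↔ a = v`;
`Ed a b :↔ x (inl (a, b))`; `W2 a j :↔ 1 ≤ j ≤ n ∧ x (inr (a, j-1))` (bit row of `2·w(a)`);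
`PN j :↔ j = n` (bit row of `2ⁿ`); `LT i j :↔ i < j`. Non-vertex arguments give `false`.
(Tuple entries are read through `Fin.cast rfl`, the arities being definitionally the literals.)
[folklore] -/
def gameTab (n : ℕ) (o : Fin n → Bool) (v : Fin n) (x : (Fin n × Fin n) ⊕ (Fin n × Fin n) → Bool) :
    RelTables inVocab (usize n) := fun s =>
  match s with
  | ⟨0, _⟩ => fun w => decide ((w (Fin.cast rfl (0 : Fin 1)) : ℕ) < n)
  | ⟨1, _⟩ => fun w => if h : (w (Fin.cast rfl (0 : Fin 1)) : ℕ) < n then o ⟨_, h⟩ else false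
  | ⟨2, _⟩ => fun w => decide ((w (Fin.cast rfl (0 : Fin 1)) : ℕ) = v)
  | ⟨3, _⟩ => fun w => if ha : (w (Fin.cast rfl (0 : Fin 2)) : ℕ) < n then
      (if hb : (w (Fin.cast rfl (1 : Fin 2)) : ℕ) < n then x (Sum.inl (⟨_, ha⟩, ⟨_, hb⟩)) else false)
      else false
  | ⟨4, _⟩ => fun w => if ha : (w (Fin.cast rfl (0 : Fin 2)) : ℕ) < n then
      (if hj : 1 ≤ (w (Fin.cast rfl (1 : Fin 2)) : ℕ) ∧ (w (Fin.cast rfl (1 : Fin 2)) : ℕ) ≤ n then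
        x (Sum.inr (⟨_, ha⟩, ⟨(w (Fin.cast rfl (1 : Fin 2)) : ℕ) - 1, by omega⟩)) else false)
      else false
  | ⟨5, _⟩ => fun w => decide ((w (Fin.cast rfl (0 : Fin 1)) : ℕ) = n)
  | ⟨6, _⟩ => fun w => decide ((w (Fin.cast rfl (0 : Fin 2)) : ℕ) < (w (Fin.cast rfl (1 : Fin 2)) : ℕ))

/-- The bit row of `2ⁿ` (the table `PN` as a Boolean row). [folklore] -/
def pnRow (n : ℕ) : Fin (usize n) → Bool := fun j => decide ((j : ℕ) = n)

/-- The bit row of `2·w(u)` (the table `W2` at a vertex, as a Boolean row). [folklore] -/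
def w2Row (x : (Fin n × Fin n) ⊕ (Fin n × Fin n) → Bool) (u : Fin n) : Fin (usize n) → Bool := fun j =>
  if hj : 1 ≤ (j : ℕ) ∧ (j : ℕ) ≤ n then x (Sum.inr (u, ⟨(j : ℕ) - 1, by omega⟩)) else false

open scoped Classical in
/-- **Even wins the threshold mean-payoff game** `(n, o, v)` on input `x` — the route's inline
predicate, verbatim (owners `o`, `true` = Even; bit `x (inl (u, w))` = "edge `u → w` present" if
`o u`, "edge ABSENT" if `¬ o u`; weight `w(u) = Σⱼ [x (inr (u, j))]·2ʲ`; `C` = the vertices visited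
infinitely often by the lasso from `v` under the merged positional strategies).
[cite: ZwickPaterson1996, §1 (mean-payoff decision problem)] -/
def MpgWin (n : ℕ) (o : Fin n → Bool) (v : Fin n) (x : (Fin n × Fin n) ⊕ (Fin n × Fin n) → Bool) : Prop :=
  ∃ σ : Fin n → Fin n, (∀ u, o u = true → x (Sum.inl (u, σ u)) = true) ∧ ∀ τ : Fin n → Fin n,
    (∀ u, o u = false → x (Sum.inl (u, τ u)) = false) →
      let C : Finset (Fin n) := Finset.univ.filter fun u : Fin n =>
        ∃ᶠ t : ℕ in Filter.atTop, (fun w : Fin n => if o w = true then σ w else τ w)^[t] v = u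
      2 ^ n * C.card ≤ 2 * ∑ u ∈ C, ∑ j : Fin n, if x (Sum.inr (u, j)) = true then 2 ^ (j : ℕ) else 0

end Games

/-! ### The witness tables of the completeness proof -/

section Witness

variable {n : ℕ} (o : Fin n → Bool) (v : Fin n) (x : (Fin n × Fin n) ⊕ (Fin n × Fin n) → Bool)
  (σ : Fin n → Fin n) (Rset : Set (Fin n)) (PhiN : Fin (usize n) → ℕ)

/-- Row of the (shifted, natural) potential of `a`. [folklore] -/
def phRowOf (a : Fin (usize n)) : Fin (usize n) → Bool := natRow (usize n) (PhiN a)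

/-- The table `W2` of the game at `a`, as a Boolean row. [folklore] -/
def w2TabRow (a : Fin (usize n)) : Fin (usize n) → Bool := fun j => gameTab n o v x iW2 ![a, j]

/-- Sum row of `Φ a + 2ⁿ`. [folklore] -/
def s1RowOf (a : Fin (usize n)) : Fin (usize n) → Bool := sumRow (phRowOf PhiN a) (pnRow n)

/-- Sum row of `Φ a + 2·w(a)`. [folklore] -/
def s2RowOf (a : Fin (usize n)) : Fin (usize n) → Bool := sumRow (phRowOf PhiN a) (w2TabRow o v x a)

/-- Row of the difference `(Φ a + 2·w(a)) - (Φ b + 2ⁿ)` (truncated). [folklore] -/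
def ddRowOf (a b : Fin (usize n)) : Fin (usize n) → Bool :=
  natRow (usize n) (Nat.ofBits (s2RowOf o v x PhiN a) - Nat.ofBits (s1RowOf PhiN b))

open scoped Classical in
/-- **The witness tables**: `Sg a b :↔ b = σ a`; `Rr a :↔ a ∈ R`; `Ph` the potential rows; `S1, C1`,
`S2, C2`, `Dd, C3` the school additions `Ph + PN`, `Ph + W2`, `S1 b + Dd a b` (tuple entries read
through `Fin.cast rfl` as in `gameTab`). [folklore] -/
noncomputable def witTab : RelTables witVocab (usize n) := fun s =>
  match s with
  | ⟨0, _⟩ => fun w => if ha : (w (Fin.cast rfl (0 : Fin 2)) : ℕ) < n then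
      decide ((w (Fin.cast rfl (1 : Fin 2)) : ℕ) = σ ⟨_, ha⟩) else false
  | ⟨1, _⟩ => fun w => if ha : (w (Fin.cast rfl (0 : Fin 1)) : ℕ) < n then decide (⟨_, ha⟩ ∈ Rset) else false
  | ⟨2, _⟩ => fun w => phRowOf PhiN (w (Fin.cast rfl (0 : Fin 2))) (w (Fin.cast rfl (1 : Fin 2)))
  | ⟨3, _⟩ => fun w => s1RowOf PhiN (w (Fin.cast rfl (0 : Fin 2))) (w (Fin.cast rfl (1 : Fin 2)))
  | ⟨4, _⟩ => fun w => carryRow (phRowOf PhiN (w (Fin.cast rfl (0 : Fin 2)))) (pnRow n)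
      (w (Fin.cast rfl (1 : Fin 2)))
  | ⟨5, _⟩ => fun w => s2RowOf o v x PhiN (w (Fin.cast rfl (0 : Fin 2))) (w (Fin.cast rfl (1 : Fin 2)))
  | ⟨6, _⟩ => fun w => carryRow (phRowOf PhiN (w (Fin.cast rfl (0 : Fin 2))))
      (w2TabRow o v x (w (Fin.cast rfl (0 : Fin 2)))) (w (Fin.cast rfl (1 : Fin 2)))
  | ⟨7, _⟩ => fun w => ddRowOf o v x PhiN (w (Fin.cast rfl (0 : Fin 3))) (w (Fin.cast rfl (1 : Fin 3)))
      (w (Fin.cast rfl (2 : Fin 3)))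
  | ⟨8, _⟩ => fun w => carryRow (s1RowOf PhiN (w (Fin.cast rfl (1 : Fin 3))))
      (ddRowOf o v x PhiN (w (Fin.cast rfl (0 : Fin 3))) (w (Fin.cast rfl (1 : Fin 3)))) (w (Fin.cast rfl (2 : Fin 3)))

end Witness

section OddArena

variable {n : ℕ} (o : Fin n → Bool) (v : Fin n) (x : (Fin n × Fin n) ⊕ (Fin n × Fin n) → Bool)

/-- The successor relation left to Odd once Even follows `σ`: `u → σ u` at Even vertices, every
legal (bit `0`) edge at Odd vertices. [folklore] -/
def oddArena (σ : Fin n → Fin n) (u w : Fin n) : Prop :=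
  (o u = true ∧ w = σ u) ∨ (o u = false ∧ x (Sum.inl (u, w)) = false)

end OddArena

/-! ### The code of a game structure -/

/-- The length of the code of every `n`-vertex game structure. [folklore] -/
def codeLenG (n : ℕ) : ℕ := 2 * Nat.size (usize n) + 2 + tableBits inVocab (usize n)

section Code

variable {n : ℕ} (o : Fin n → Bool) (v : Fin n)

/-- The code of the game structure has length `codeLenG n`. [folklore] -/
theorem length_code (x : (Fin n × Fin n) ⊕ (Fin n × Fin n) → Bool) :
    (codeOf (gameTab n o v x)).length = codeLenG n := length_codeOf _

/-- Bit `j` of the code of the game structure, as a function of the input `x`. [folklore] -/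
def codeBitG (j : Fin (codeLenG n)) (x : (Fin n × Fin n) ⊕ (Fin n × Fin n) → Bool) : Bool :=
  (codeOf (gameTab n o v x))[(j : ℕ)]'(by rw [length_code]; exact j.2)

end Code

end Summit.PneNP.PneNP.Theorems.MpgNP
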